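import Summits.AtomisticToContinuum.BoseEinsteinCondensation.Theorems.BECThomsonPrincipleFibreConductanceStubMomentOfCDMCube
import Summits.AtomisticToContinuum.BoseEinsteinCondensation.Theorems.BECThomsonPrincipleFibreConductanceStubMomentOfCDMBath
import HarnessLib

/-!
# Route `BECThomsonPrinciple`, crux `FibreConductance` (stmt-AtomisticToContinuum-9480),
# line `conditional-law-poincare` — stub `stub_momentOfCDM`: THE LEVER IN SOBOLEV FORM

`stub_momentOfCDM : Goal.stub_momentOfCDM` (`= LocalChargeSqBound → ConditionalDensityMoments →
SobolevMomentBound`, `…FibreConductanceConditionalDefs`): the bath moment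
`sobolevLevelOf = L⁻³∫_{cellN} W Σ_Q U_Q P_Q` of the crux's charge at the wavelength tiling is
`≤ A·L²/‖n‖²` for exact zero-free minimisers at low density, GIVEN gen 1's shared landscape input
`ConditionalDensityMoments` (two-sided moments of `g = L³ψ²` at uniform locations, `p = 6`).
Composition of the two landed halves: part A `cubeMoment_le` (per cube and fibre,
`U_QP_Q ≤ (5ℓ²/L³)∫_Q(1 + g⁶ + g⁻⁶)`: the local charge bound, Cauchy–Schwarz `1/m₁ ≤ m₋₁`, Young,
Jensen, pointwise `x ≤ 1 + x²`) and part B `sobolevMomentBound_of_cubeMoment` (sum over cubes, fibre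
Fubini, `∫W = L³`, the moment input, `ℓ = L/‖n‖_∞`, `A = 5(1 + C₆)`). [folklore]
-/

noncomputable section

namespace Summit.AtomisticToContinuum.BoseEinsteinCondensation.Cruxes.FibreConductance.ConditionalLawPoincare

/-- **`stub_momentOfCDM` — the line's lever in Sobolev form**: `LocalChargeSqBound →
ConditionalDensityMoments → SobolevMomentBound` (part A `cubeMoment_le` + part B
`sobolevMomentBound_of_cubeMoment`). [folklore] -/
theorem stub_momentOfCDM : Goal.stub_momentOfCDM :=
  fun lcs cdm => sobolevMomentBound_of_cubeMoment (cubeMoment_le lcs) cdm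

end Summit.AtomisticToContinuum.BoseEinsteinCondensation.Cruxes.FibreConductance.ConditionalLawPoincare

end
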